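import Literature.NumberTheory.EllipticCurves.HasseWeilAbelianPotentialGoodReductionProofs
import HarnessLib

/-!
# `V_ℓ E` is tame at the places of integral `j` and residue characteristic `≥ 5`
# (Silverman *ATAEC* Thm. IV.10.2(b), clause `p ≥ 5`, case `v(j) ≥ 0`), proofs

`Proofs` file (theorems only, no definitions, no named facts) in topic
`NumberTheory/EllipticCurves`, landed by the tenured seat of bsd.S15
(`Literature.NumberTheory.EllipticCurves.conductorNorm_eq_artinConductorNat`, `BSDConductor`) as a
bottom-up step below the named fact
`WeierstrassCurve.swanConductorAt_rationalTate_eq_zero_of_ringChar_ne` of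
`HasseWeilAbelianConductor` — Silverman, *Advanced Topics in the Arithmetic of Elliptic Curves*,
Thm. IV.10.2(b): *"If `E/K` has good or multiplicative reduction, or if `p ≥ 5`, then
`δ(E/K) = 0`"* (PDF p. 358 of the held copy), clause `p ≥ 5`, in the tree's Galois form
`Sw_𝔓(V_ℓ E) = 0` at the places `v ∤ ℓ` of residue characteristic `≠ 2, 3`.

The printed proof (PDF pp. 359–362) splits by the sign of `v(j)`: for `v(j) < 0` the Tate curve
(V.5.3, Ex. 5.11), for `v(j) ≥ 0` Prop. IV.10.3 (good reduction over `K(E[3])`, a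
`{2, 3}`-extension, hence `p ∤ #I(L/K)` for `p ≥ 5`).  The predecessor file
`HasseWeilAbelianPotentialGoodReductionProofs` proved the **case `v(j) ≥ 0`** at the level of
torsion points, with the Kummer extension `K(¹²√Δ)` in place of `K(E[3])`:
`WeierstrassCurve.smul_torsion_eq_self_of_mem_absUpperRamificationSubgroup_of_valuation_j_le_one`
— every `σ` in a wild ramification group `Γ_K^u(𝔓)`, `u > 0`, `𝔓 ∣ v`, `v ∤ 6`, `ord_v(j) ≥ 0`,
fixes every `E[m]` with `v ∤ m`.  This file draws the conclusion for the `ℓ`-adic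
representation:

* `WeierstrassCurve.galoisRepTate_eq_one_of_forall_smul_torsion_eq`,
  `WeierstrassCurve.isTameAt_rationalTateGaloisRepOf_of_forall_smul_torsion_eq` — bookkeeping:
  an element of `Γ_K` fixing every `E[ℓⁿ]` acts trivially on `T_ℓ E` (componentwise,
  `TateModule.ext`) and on `V_ℓ E = ℚ_ℓ ⊗ T_ℓ E`; if every `σ ∈ Γ_K^u(𝔓)`, `u > 0`, does so, then
  `V_ℓ E` is tame at `𝔓` (`GaloisRep.IsTameAt`, item G09);
* `WeierstrassCurve.isTameAt_rationalTate_of_valuation_j_le_one`,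
  `WeierstrassCurve.swanConductorAt_rationalTate_eq_zero_of_valuation_j_le_one` — **Thm.
  IV.10.2(b), clause `p ≥ 5`, case `v(j) ≥ 0`, proved**: for an elliptic curve `E/K` over a
  number field, a prime `ℓ`, a finite place `v ∤ 6ℓ` with `ord_v(j) ≥ 0` and a prime `𝔓 ∣ v` of
  `\bar ℤ_K`, `V_ℓ E` is tamely ramified at `𝔓` and `Sw_𝔓(V_ℓ E) = 0`
  (`GaloisRep.IsTameAt.swanConductorAt_eq_zero`);
* `WeierstrassCurve.swanConductorAt_rationalTate_eq_zero_of_ringChar_ne_of_valuation_j_le_one` —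
  the same in the exact hypotheses of the named fact (`ringChar (𝓞 K ⧸ v) ≠ 2, 3`; bridge
  `IsDedekindDomain.HeightOneSpectrum.natCast_notMem_of_ringChar_ne`);
* `WeierstrassCurve.swanConductorAt_rationalTate_eq_zero_of_ringChar_ne_of_negative_j` — **the
  named fact reduced to its case `v(j) < 0`** (potentially multiplicative reduction; printed
  proof via the Tate curve, PDF pp. 359–360), taken as the hypothesis `hneg`.

So of Thm. IV.10.2(b) there remain, as inputs not yet proved in the tree, the case `v(j) < 0` at
the additive places of residue characteristic `≥ 5` (the multiplicative places being the theorem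
`swanConductorAt_rationalTate_eq_zero_of_hasMultiplicativeReductionAt_of_codim` of
`BSDConductorSemistableProofs`, from Thm. IV.10.2(a) there).

All axioms `propext`, `Classical.choice`, `Quot.sound`.

## References

* J. H. Silverman, *Advanced Topics in the Arithmetic of Elliptic Curves*, GTM 151 (1994), §IV.10,
  Thm. 10.2(b) and its proof (PDF pp. 358–362), Prop. 10.3. [SilvermanATAEC1994]
* J. H. Silverman, *The Arithmetic of Elliptic Curves*, 2nd ed. (2009), Prop. VII.4.1,
  Prop. VII.5.5. [SilvermanAEC2009]
* J.-P. Serre, *Local Fields*, GTM 67 (1979), Ch. IV §3 (upper numbering), Ch. VI §2 (Swan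
  conductor). [SerreLocalFields1979]

## Design

No definitions; `noncomputable section`; one universe `u`; deliberate dot-notation extensions of
Mathlib's `WeierstrassCurve` and `IsDedekindDomain.HeightOneSpectrum` namespaces, as in the
sibling files.  The representation is written `rationalTateGaloisRepOf (geomPoints W) ℓ h` (the
spelling of `HasseWeilAbelian` / `HasseWeilAbelianConductor`, definitionally
`W.rationalTateGaloisRep ℓ h`), with the continuity proof `h` an explicit hypothesis.
-/

noncomputable section

open scoped Classical NumberField
open Field IsDedekindDomain

universe u

/-! ### Residue characteristic versus membership of a rational prime in `v` -/

namespace IsDedekindDomain.HeightOneSpectrum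

variable {K : Type u} [Field K] (v : HeightOneSpectrum (𝓞 K))

/-- The residue characteristic of `v` lies in `v`: `(char (𝓞 K ⧸ v) : 𝓞 K) ∈ v`. [folklore] -/
theorem natCast_ringChar_mem : ((ringChar (𝓞 K ⧸ v.asIdeal) : ℕ) : 𝓞 K) ∈ v.asIdeal := by
  rw [← Ideal.Quotient.eq_zero_iff_mem, map_natCast]
  exact ringChar.Nat.cast_ringChar

/-- If the residue characteristic of `v` is not the prime `p`, then `p ∉ v` (the residue
characteristic is the unique rational prime in `v`). [folklore] -/
theorem natCast_notMem_of_ringChar_ne {p : ℕ} (hp : p.Prime)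
    (h : ringChar (𝓞 K ⧸ v.asIdeal) ≠ p) : (p : 𝓞 K) ∉ v.asIdeal := by
  intro hmem
  have h0 : ((p : 𝓞 K) : 𝓞 K ⧸ v.asIdeal) = 0 := (Ideal.Quotient.eq_zero_iff_mem).mpr hmem
  rw [map_natCast] at h0
  have hdvd : ringChar (𝓞 K ⧸ v.asIdeal) ∣ p := (ringChar.spec _ p).mp h0
  haveI : Nontrivial (𝓞 K ⧸ v.asIdeal) :=
    Ideal.Quotient.nontrivial_iff.mpr v.isPrime.ne_top
  rcases (Nat.dvd_prime hp).mp hdvd with h1 | h1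
  · exact CharP.ringChar_ne_one h1
  · exact h h1

/-- Conversely, if the prime `p` is not in `v` then the residue characteristic of `v` is not `p`.
[folklore] -/
theorem ringChar_ne_of_natCast_notMem {p : ℕ} (h : (p : 𝓞 K) ∉ v.asIdeal) :
    ringChar (𝓞 K ⧸ v.asIdeal) ≠ p := by
  rintro rfl
  exact h v.natCast_ringChar_mem

end IsDedekindDomain.HeightOneSpectrum

namespace WeierstrassCurve

open Literature.NumberTheory.EllipticCurves Literature.NumberTheory.GaloisRepresentations
  IsDedekindDomain.HeightOneSpectrum

variable {K : Type u} [Field K] (W : WeierstrassCurve K) (ℓ : ℕ) [Fact ℓ.Prime]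

/-! ### An element fixing every `E[ℓⁿ]` acts trivially on `T_ℓ E` and `V_ℓ E` -/

/-- An element `σ ∈ Γ_K` fixing every `ℓ`-power torsion point of `E(K̄)` acts trivially on the
Tate module `T_ℓ E = lim E[ℓⁿ]` (componentwise: `(σ a)_n = σ (a_n) = a_n`). [folklore] -/
theorem galoisRepTate_eq_one_of_forall_smul_torsion_eq {σ : absoluteGaloisGroup K}
    (hfix : ∀ (n : ℕ) (P : geomPoints W), ℓ ^ n • P = 0 → σ • P = P) :
    W.galoisRepTate ℓ σ = 1 :=
  LinearMap.ext fun a ↦ by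
    rw [galoisRepTate_apply_apply, Module.End.one_apply]
    exact TateModule.ext fun n ↦ by
      rw [TateModule.proj_smul_of_distribMulAction]
      exact hfix n _ (TateModule.pow_smul_proj n a)

/-- An element `σ ∈ Γ_K` fixing every `ℓ`-power torsion point of `E(K̄)` acts trivially on the
rational Tate module `V_ℓ E = ℚ_ℓ ⊗ T_ℓ E`. [folklore] -/
theorem rationalGaloisRepTate_eq_one_of_forall_smul_torsion_eq {σ : absoluteGaloisGroup K}
    (hfix : ∀ (n : ℕ) (P : geomPoints W), ℓ ^ n • P = 0 → σ • P = P) :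
    W.rationalGaloisRepTate ℓ σ = 1 := by
  change Module.End.baseChangeHom ℤ_[ℓ] ℚ_[ℓ] (W.tateModule ℓ) (W.galoisRepTate ℓ σ) = 1
  rw [W.galoisRepTate_eq_one_of_forall_smul_torsion_eq ℓ hfix, map_one]

/-- **Wild ramification groups fixing the `ℓ`-power torsion make `V_ℓ E` tame.**  If for every
`u > 0` every `σ ∈ Γ_K^u(𝔓)` (the absolute upper ramification group at the prime `𝔓` of
`\bar ℤ_K`, item C9) fixes every `ℓ`-power torsion point of `E(K̄)`, then the `ℓ`-adic
representation `V_ℓ E` is tamely ramified at `𝔓` (`GaloisRep.IsTameAt`: every `Γ_K^u(𝔓)`,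
`u > 0`, acts trivially), hence `Sw_𝔓(V_ℓ E) = 0` (`GaloisRep.IsTameAt.swanConductorAt_eq_zero`).
Serre, *Local Fields*, Ch. VI §2 (a representation trivial on `G_1` has no wild conductor).
[folklore] -/
theorem isTameAt_rationalTateGaloisRepOf_of_forall_smul_torsion_eq
    (h : Continuous fun x : absoluteGaloisGroup K × RationalTateModule (geomPoints W) ℓ ↦
      rationalTateRepresentation (absoluteGaloisGroup K) (geomPoints W) ℓ x.1 x.2)
    {𝔓 : Ideal (absIntegers (𝓞 K) K)}
    (hfix : ∀ ⦃u : ℝ⦄, 0 < u → ∀ ⦃σ : absoluteGaloisGroup K⦄,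
      σ ∈ absUpperRamificationSubgroup (𝓞 K) 𝔓 u →
        ∀ (n : ℕ) (P : geomPoints W), ℓ ^ n • P = 0 → σ • P = P) :
    (rationalTateGaloisRepOf (geomPoints W) ℓ h).IsTameAt (𝓞 K) 𝔓 :=
  fun _ hu _ hσ ↦ W.rationalGaloisRepTate_eq_one_of_forall_smul_torsion_eq ℓ (hfix hu hσ)

/-! ### Thm. IV.10.2(b), clause `p ≥ 5`, at the places of integral `j` -/

variable [NumberField K]

/-- **`V_ℓ E` is tame at the places `v ∤ 6ℓ` of integral `j`** (Silverman *ATAEC*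
Thm. IV.10.2(b), clause `p ≥ 5`, case `v(j) ≥ 0`, in Galois form).  For an elliptic curve `E/K`
over a number field, a prime `ℓ`, a finite place `v` with `v ∤ ℓ`, `2, 3 ∉ v` and
`ord_v(j(E)) ≥ 0` (`v.valuation K W.j ≤ 1`), and a prime `𝔓 ∣ v` of `\bar ℤ_K`, every wild
ramification group `Γ_K^u(𝔓)`, `u > 0`, acts trivially on `V_ℓ E`: it fixes every `E[ℓⁿ]`
(`smul_torsion_eq_self_of_mem_absUpperRamificationSubgroup_of_valuation_j_le_one`: good reduction
over the `{2,3}`-extension `K(¹²√Δ)`, *AEC* VII.5.5 with VII.4.1, in place of the book's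
Prop. IV.10.3), hence acts trivially on `T_ℓ E` and `V_ℓ E`.
[cite: SilvermanATAEC1994, Thm. IV.10.2(b), clause p ≥ 5, case v(j) ≥ 0 (PDF pp. 358–362)] -/
theorem isTameAt_rationalTate_of_valuation_j_le_one [W.IsElliptic]
    (h : Continuous fun x : absoluteGaloisGroup K × RationalTateModule (geomPoints W) ℓ ↦
      rationalTateRepresentation (absoluteGaloisGroup K) (geomPoints W) ℓ x.1 x.2)
    {v : HeightOneSpectrum (𝓞 K)} (hℓ : (ℓ : 𝓞 K) ∉ v.asIdeal) (hj : v.valuation K W.j ≤ 1)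
    (h2 : (2 : 𝓞 K) ∉ v.asIdeal) (h3 : (3 : 𝓞 K) ∉ v.asIdeal)
    {𝔓 : Ideal (absIntegers (𝓞 K) K)} (h𝔓 : 𝔓 ∈ v.primesAbove) :
    (rationalTateGaloisRepOf (geomPoints W) ℓ h).IsTameAt (𝓞 K) 𝔓 :=
  W.isTameAt_rationalTateGaloisRepOf_of_forall_smul_torsion_eq ℓ h fun _ hu _ hσ n P hP ↦
    W.smul_torsion_eq_self_of_mem_absUpperRamificationSubgroup_of_valuation_j_le_one hj h2 h3 h𝔓
      hu hσ (v.natCast_pow_not_mem hℓ n) P hP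

/-- **`Sw_𝔓(V_ℓ E) = 0` at the places `v ∤ 6ℓ` of integral `j`** (Silverman *ATAEC*
Thm. IV.10.2(b): *"… or if `p ≥ 5`, then `δ(E/K) = 0`"*, case `v(j) ≥ 0`, in Galois form: the
Swan conductor of the `ℓ`-adic representation at `𝔓` vanishes), from
`isTameAt_rationalTate_of_valuation_j_le_one` and `GaloisRep.IsTameAt.swanConductorAt_eq_zero`.
[cite: SilvermanATAEC1994, Thm. IV.10.2(b), clause p ≥ 5, case v(j) ≥ 0 (PDF pp. 358–362)] -/
theorem swanConductorAt_rationalTate_eq_zero_of_valuation_j_le_one [W.IsElliptic]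
    (h : Continuous fun x : absoluteGaloisGroup K × RationalTateModule (geomPoints W) ℓ ↦
      rationalTateRepresentation (absoluteGaloisGroup K) (geomPoints W) ℓ x.1 x.2)
    {v : HeightOneSpectrum (𝓞 K)} (hℓ : (ℓ : 𝓞 K) ∉ v.asIdeal) (hj : v.valuation K W.j ≤ 1)
    (h2 : (2 : 𝓞 K) ∉ v.asIdeal) (h3 : (3 : 𝓞 K) ∉ v.asIdeal)
    {𝔓 : Ideal (absIntegers (𝓞 K) K)} (h𝔓 : 𝔓 ∈ v.primesAbove) :
    (rationalTateGaloisRepOf (geomPoints W) ℓ h).swanConductorAt (𝓞 K) 𝔓 = 0 :=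
  (W.isTameAt_rationalTate_of_valuation_j_le_one ℓ h hℓ hj h2 h3 h𝔓).swanConductorAt_eq_zero

/-- **Thm. IV.10.2(b), clause `p ≥ 5`, case `v(j) ≥ 0`, in the hypotheses of the named fact
`swanConductorAt_rationalTate_eq_zero_of_ringChar_ne`** (residue characteristic
`ringChar (𝓞 K ⧸ v) ≠ 2, 3` rather than `2, 3 ∉ v`; the two agree,
`IsDedekindDomain.HeightOneSpectrum.natCast_notMem_of_ringChar_ne`).
[cite: SilvermanATAEC1994, Thm. IV.10.2(b), clause p ≥ 5, case v(j) ≥ 0 (PDF pp. 358–362)] -/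
theorem swanConductorAt_rationalTate_eq_zero_of_ringChar_ne_of_valuation_j_le_one [W.IsElliptic]
    (h : Continuous fun x : absoluteGaloisGroup K × RationalTateModule (geomPoints W) ℓ ↦
      rationalTateRepresentation (absoluteGaloisGroup K) (geomPoints W) ℓ x.1 x.2)
    (v : HeightOneSpectrum (𝓞 K)) (hℓ : (ℓ : 𝓞 K) ∉ v.asIdeal)
    (h2 : ringChar (𝓞 K ⧸ v.asIdeal) ≠ 2) (h3 : ringChar (𝓞 K ⧸ v.asIdeal) ≠ 3)
    (hj : v.valuation K W.j ≤ 1)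
    {𝔓 : Ideal (absIntegers (𝓞 K) K)} (h𝔓 : 𝔓 ∈ v.primesAbove) :
    (rationalTateGaloisRepOf (geomPoints W) ℓ h).swanConductorAt (𝓞 K) 𝔓 = 0 :=
  W.swanConductorAt_rationalTate_eq_zero_of_valuation_j_le_one ℓ h hℓ hj
    (by simpa using v.natCast_notMem_of_ringChar_ne Nat.prime_two h2)
    (by simpa using v.natCast_notMem_of_ringChar_ne Nat.prime_three h3) h𝔓

/-- **The named fact `swanConductorAt_rationalTate_eq_zero_of_ringChar_ne W ℓ` (Silverman
*ATAEC* Thm. IV.10.2(b), clause `p ≥ 5`) reduced to its case `v(j) < 0`.**  Granted the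
vanishing of `Sw_𝔓(V_ℓ E)` at the places `v ∤ 6ℓ` with `ord_v(j) < 0` (`1 < v.valuation K W.j`;
potentially multiplicative reduction — printed proof through the Tate curve over an extension of
degree `≤ 2`, PDF pp. 359–360, hypothesis `hneg`), the whole clause follows, the places of
integral `j` being `swanConductorAt_rationalTate_eq_zero_of_ringChar_ne_of_valuation_j_le_one`.
[cite: SilvermanATAEC1994, Thm. IV.10.2(b), clause p ≥ 5, and its proof (PDF pp. 358–362)] -/
theorem swanConductorAt_rationalTate_eq_zero_of_ringChar_ne_of_negative_j
    (hneg : ∀ [W.IsElliptic]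
      (h : Continuous fun x : absoluteGaloisGroup K × RationalTateModule (geomPoints W) ℓ ↦
        rationalTateRepresentation (absoluteGaloisGroup K) (geomPoints W) ℓ x.1 x.2)
      (v : HeightOneSpectrum (𝓞 K)) (_hℓ : (ℓ : 𝓞 K) ∉ v.asIdeal)
      (_h2 : ringChar (𝓞 K ⧸ v.asIdeal) ≠ 2) (_h3 : ringChar (𝓞 K ⧸ v.asIdeal) ≠ 3)
      (_hj : 1 < v.valuation K W.j)
      {𝔓 : Ideal (absIntegers (𝓞 K) K)} (_h𝔓 : 𝔓 ∈ v.primesAbove),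
      (rationalTateGaloisRepOf (geomPoints W) ℓ h).swanConductorAt (𝓞 K) 𝔓 = 0) :
    W.swanConductorAt_rationalTate_eq_zero_of_ringChar_ne ℓ := by
  intro _ h v hℓ h2 h3 𝔓 h𝔓
  by_cases hj : v.valuation K W.j ≤ 1
  · exact W.swanConductorAt_rationalTate_eq_zero_of_ringChar_ne_of_valuation_j_le_one ℓ h v hℓ h2
      h3 hj h𝔓
  · exact hneg h v hℓ h2 h3 (not_le.mp hj) h𝔓

end WeierstrassCurve

end
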